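import Summits.ValiantsHypothesis.ValiantsHypothesis.Theorems.PolyaContinuedLaplaceRigiditySingGenericPoint
import Summits.ValiantsHypothesis.ValiantsHypothesis.Theorems.PolyaContinuedLaplaceRigiditySingCodimEight

/-!
# Top-dimensional components of `Sing(per₄)` with exactly one zero line, part 2a: the kernel equations
# (the «K-core» of stub B-row of line `component_rigidity`, generic-point half)

Helper file for crux `CoverDecancellation` (stmt-ValiantsHypothesis-17819), line `laplace_rigidity`,
rung row R3 at width 4 (`str₂(per₄) ≥ 5`), read against val-idea-10 g3's line «component_rigidity»
(workfile v4, registered stub `stub_rowPrimeRigidity`).  For a prime `P ⊇ subpermIdeal F 4 4 3` and a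
point `z` over a field `L ⊇ F` with `ker (f ↦ f(z)) = P` (generic point), three rows `u = z_j`,
`v = z_k`, `r = z_l` and `w_ab = u_a v_b + u_b v_a`:

* `subperm_vanish_of_ker`, `subperm_rows_eq_zero` (T1) — the `3 × 3` sub-permanents of rows `j,k,l`
  vanish at `z`: `w_{c₀c₁} r_{c₂} + w_{c₀c₂} r_{c₁} + w_{c₁c₂} r_{c₀} = 0`, i.e. `M(u,v) · r = 0` for the
  symmetric zero-diagonal matrix `M_cd = w_{[4]∖{c,d}}`;
* `eight_le_trdeg` (T3) — `8 ≤ trdeg_F F[z]` when `height P ≤ 8`; `X_mem_iff_eq_zero`;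
* `kernel_solve`, `kernel_schur`, `kernel_det` — elimination at a pivot `m = M_cd ≠ 0`
  (`p = M_ce, q = M_cf, s = M_de, t = M_df, n = M_ef`): `r_c, r_d` are determined by `r_e, r_f`, which
  satisfy the Schur system `A r_e + B r_f = 0`, `B r_e + C r_f = 0` with `A = −2ps`, `C = −2qt`,
  `B = mn − pt − sq`, and `B² = AC` whenever `(r_e, r_f) ≠ 0`.

Part 2b (`…SingKCoreLine`) derives the kernel line `trdeg_F F[z] ≤ trdeg_F F[u,v] + 1`.  Honest
framing: bookkeeping; `str₂(per₄) ≥ 5`, `StrengthTwoPerFour` (stmt-25160), `CentralLaplaceRigidity`,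
`CoverDecancellation`, VP ≠ VNP are OPEN and NOT moved; no summit statement is touched.
val-width-17819-w1 g2, 2026-08-28.  [folklore] throughout; the sub-permanent bookkeeping follows
[BoraleviCarliniMichalekVentura2025] Cor. 3.2.
-/

set_option linter.dupNamespace false

noncomputable section

namespace Summit.ValiantsHypothesis.ValiantsHypothesis.Theorems.PolyaContinuedLaplaceRigidity.SingCodim

open MvPolynomial Cardinal
open Literature.Computability.AlgebraicComplexity
open Literature.Computability.AlgebraicComplexity.BoraleviCarliniMichalekVentura2025

variable {F : Type*} [Field F] {L : Type*} [Field L] [Algebra F L]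

/-! ### Linear algebra of the kernel of `M(u,v)` at a pivot -/

/-- **Kernel at a pivot.**  The four equations `M(u,v) r = 0` in the labelling `{c,d,e,f} = [4]`
(`m = M_cd`, `p = M_ce`, `q = M_cf`, `s = M_de`, `t = M_df`, `n = M_ef`) with pivot `m ≠ 0`
determine `r_c, r_d` from `r_e, r_f`. [folklore] -/
theorem kernel_solve {m p q s t rc rd re rf : L}
    (hc : m * rd + p * re + q * rf = 0) (hd : m * rc + s * re + t * rf = 0) :
    rc * m = -(s * re + t * rf) ∧ rd * m = -(p * re + q * rf) := by
  constructor
  · linear_combination hd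
  · linear_combination hc

/-- **Schur system.**  Eliminating `r_c, r_d` at the pivot `m ≠ 0` leaves
`A r_e + B r_f = 0`, `B r_e + C r_f = 0` with `A = −2ps`, `C = −2qt`, `B = mn − pt − sq`. [folklore] -/
theorem kernel_schur {m p q s t n rc rd re rf : L}
    (hc : m * rd + p * re + q * rf = 0) (hd : m * rc + s * re + t * rf = 0)
    (he : p * rc + s * rd + n * rf = 0) (hf : q * rc + t * rd + n * re = 0) :
    (-(2 * p * s)) * re + (m * n - p * t - s * q) * rf = 0 ∧
      (m * n - p * t - s * q) * re + (-(2 * q * t)) * rf = 0 := by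
  constructor
  · linear_combination m * he - p * hd - s * hc
  · linear_combination m * hf - q * hd - t * hc

/-- **The determinant at a non-trivial kernel vector.**  If moreover `(r_e, r_f) ≠ (0,0)` then
`B² = AC`. [folklore] -/
theorem kernel_det {A B C re rf : L} (h1 : A * re + B * rf = 0) (h2 : B * re + C * rf = 0)
    (hne : re ≠ 0 ∨ rf ≠ 0) : B * B = A * C := by
  rcases hne with hre | hrf
  · have key : (B * B - A * C) * re = 0 := by linear_combination B * h2 - C * h1
    rcases mul_eq_zero.1 key with h | h
    · linear_combination h
    · exact absurd h hre
  · have key : (B * B - A * C) * rf = 0 := by linear_combination B * h1 - A * h2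
    rcases mul_eq_zero.1 key with h | h
    · linear_combination h
    · exact absurd h hrf


/-! ### The sub-permanent equations at a point with kernel `P` -/

/-- **The `3 × 3` sub-permanents vanish at a point whose kernel contains them** (explicit form).
[cite: BoraleviCarliniMichalekVentura2025, Cor. 3.2] -/
theorem subperm_vanish_of_ker {P : Ideal (MvPolynomial (Fin 4 × Fin 4) F)}
    (hle : subpermIdeal F 4 4 3 ≤ P) (z : Fin 4 × Fin 4 → L)
    (hker : RingHom.ker (aeval (R := F) z) = P) :
    ∀ r₀ r₁ r₂ c₀ c₁ c₂ : Fin 4, r₀ ≠ r₁ → r₀ ≠ r₂ → r₁ ≠ r₂ → c₀ ≠ c₁ → c₀ ≠ c₂ → c₁ ≠ c₂ →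
      z (r₀, c₀) * (z (r₁, c₁) * z (r₂, c₂) + z (r₁, c₂) * z (r₂, c₁)) +
        z (r₀, c₁) * (z (r₁, c₀) * z (r₂, c₂) + z (r₁, c₂) * z (r₂, c₀)) +
        z (r₀, c₂) * (z (r₁, c₀) * z (r₂, c₁) + z (r₁, c₁) * z (r₂, c₀)) = 0 := by
  classical
  intro r₀ r₁ r₂ c₀ c₁ c₂ h₀₁ h₀₂ h₁₂ k₀₁ k₀₂ k₁₂
  have hRc : ({r₀, r₁, r₂} : Finset (Fin 4)).card = 3 := by
    rw [Finset.card_insert_of_notMem (by simp [h₀₁, h₀₂]), Finset.card_pair h₁₂]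
  have hCc : ({c₀, c₁, c₂} : Finset (Fin 4)).card = 3 := by
    rw [Finset.card_insert_of_notMem (by simp [k₀₁, k₀₂]), Finset.card_pair k₁₂]
  have hmem : rsubperm (Matrix.mvPolynomialX (Fin 4) (Fin 4) F) (· ∈ ({c₀, c₁, c₂} : Finset (Fin 4)))
      (· ∈ ({r₀, r₁, r₂} : Finset (Fin 4))) ∈ P :=
    hle (rsubperm_mem_subpermIdeal hRc hCc)
  rw [← hker, RingHom.mem_ker, aeval_rsubperm_X,
    AlperBogartVelasco.rsubperm_triple _ h₀₁ h₀₂ h₁₂ k₀₁ k₀₂ k₁₂] at hmem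
  simpa only [Matrix.of_apply] using hmem

/-- **T1: `M(u,v) · r = 0`.**  For three rows `j, k, l` and three columns `c₀, c₁, c₂`:
`w_{c₀c₁} r_{c₂} + w_{c₀c₂} r_{c₁} + w_{c₁c₂} r_{c₀} = 0` with `w_ab = u_a v_b + u_b v_a`.
[cite: BoraleviCarliniMichalekVentura2025, Cor. 3.2] -/
theorem subperm_rows_eq_zero {P : Ideal (MvPolynomial (Fin 4 × Fin 4) F)}
    (hle : subpermIdeal F 4 4 3 ≤ P) (z : Fin 4 × Fin 4 → L)
    (hker : RingHom.ker (aeval (R := F) z) = P) {j k l : Fin 4} (hjk : j ≠ k) (hjl : j ≠ l)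
    (hkl : k ≠ l) {c₀ c₁ c₂ : Fin 4} (k₀₁ : c₀ ≠ c₁) (k₀₂ : c₀ ≠ c₂) (k₁₂ : c₁ ≠ c₂) :
    (z (j, c₀) * z (k, c₁) + z (j, c₁) * z (k, c₀)) * z (l, c₂) +
      (z (j, c₀) * z (k, c₂) + z (j, c₂) * z (k, c₀)) * z (l, c₁) +
      (z (j, c₁) * z (k, c₂) + z (j, c₂) * z (k, c₁)) * z (l, c₀) = 0 := by
  linear_combination subperm_vanish_of_ker hle z hker j k l c₀ c₁ c₂ hjk hjl hkl k₀₁ k₀₂ k₁₂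

/-- **T3: `8 ≤ trdeg_F F[z]`** at a point with kernel `P` of height `≤ 8`. [folklore] -/
theorem eight_le_trdeg {P : Ideal (MvPolynomial (Fin 4 × Fin 4) F)} (h8 : P.height ≤ 8)
    (z : Fin 4 × Fin 4 → L) (hker : RingHom.ker (aeval (R := F) z) = P) :
    (8 : Cardinal) ≤ Algebra.trdeg F (Algebra.adjoin F (Set.range z)) := by
  have h := natCast_le_trdeg_of_height_ker_aeval_le (F := F) z (m := 8) (by rw [hker]; exact h8)
  simpa using h

/-- A variable lies in the kernel iff the coordinate vanishes. [folklore] -/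
theorem X_mem_iff_eq_zero {P : Ideal (MvPolynomial (Fin 4 × Fin 4) F)} (z : Fin 4 × Fin 4 → L)
    (hker : RingHom.ker (aeval (R := F) z) = P) (e : Fin 4 × Fin 4) :
    (X e : MvPolynomial (Fin 4 × Fin 4) F) ∈ P ↔ z e = 0 := by
  rw [← hker, RingHom.mem_ker, aeval_X]


end Summit.ValiantsHypothesis.ValiantsHypothesis.Theorems.PolyaContinuedLaplaceRigidity.SingCodim

end
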